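import Mathlib
import Summits.Ventures.PercRepro2.Defs
import Summits.Ventures.PercRepro2.Graph
import Summits.Ventures.PercRepro2.Harris
import Summits.Ventures.PercRepro2.Events
import Summits.Ventures.PercRepro2.Independence
import Summits.Ventures.PercRepro2.Induced
import Summits.Ventures.PercRepro2.Exploration
import Summits.Ventures.PercRepro2.SideCluster
import Summits.Ventures.PercRepro2.CactusDefs
import Summits.Ventures.PercRepro2.CactusTriangle
import Summits.Ventures.PercRepro2.CactusTriangleMass
import Summits.Ventures.PercRepro2.CactusCluster

/-!
# Deleting the edges at a vertex from a triangular cactus (blind cell PercRepro2, mine-c g11)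

`IsCactusFrom.sep_notMem`: if `F` is a triangular cactus built from the root, so is the set of
edges of `F` not at a vertex `v` — the construction is replayed, dropping the pendant edges at `v`
and turning a pendant triangle through `v` into the pendant edge opposite to `v`. Consequently
the cactus hypothesis on `G[C ∪ {a}]` implies the one on `G[C]` (`isCactusFrom_within_of_insert`),
which makes the articulation theorem's hypothesis the paper's single one.
-/

namespace Summit.Ventures.PercRepro2

namespace Cactus

open scoped Classical

variable {V : Type*} {E : Type*}

/-- Deleting the edges at `v` from a triangular cactus built from the root gives a triangular cactus
built from the root. -/
theorem IsCactusFrom.sep_notMem {ends : E → Sym2 V} {s : V} {F : Set E} (h : IsCactusFrom ends s F)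
    (v : V) : IsCactusFrom ends s {e ∈ F | v ∉ ends e} := by
  induction h with
  | empty =>
    rw [show {e ∈ (∅ : Set E) | v ∉ ends e} = ∅ from Set.ext fun e => by simp]
    exact IsCactusFrom.empty
  | @edge F _ e x y he hxy hys hy heF ih =>
    by_cases hv : v ∈ ends e
    · rw [show {e' ∈ insert e F | v ∉ ends e'} = {e' ∈ F | v ∉ ends e'} from Set.ext fun e' => by
        simp only [Set.mem_setOf_eq, Set.mem_insert_iff]
        constructor
        · rintro ⟨h1 | h1, h2⟩
          · exact (h2 (h1 ▸ hv)).elim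
          · exact ⟨h1, h2⟩
        · rintro ⟨h1, h2⟩; exact ⟨Or.inr h1, h2⟩]
      exact ih
    · rw [show {e' ∈ insert e F | v ∉ ends e'} = insert e {e' ∈ F | v ∉ ends e'} from
        Set.ext fun e' => by
          simp only [Set.mem_setOf_eq, Set.mem_insert_iff]
          constructor
          · rintro ⟨h1 | h1, h2⟩
            · exact Or.inl h1
            · exact Or.inr ⟨h1, h2⟩
          · rintro (h1 | ⟨h1, h2⟩)
            · exact ⟨Or.inl h1, h1 ▸ hv⟩
            · exact ⟨Or.inr h1, h2⟩]
      exact IsCactusFrom.edge ih he hxy hys (fun e' he' => hy e' he'.1) (fun h' => heF h'.1)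
  | @triangle F _ e₁ e₂ e₃ x y z h₁ h₂ h₃ hxy hxz hyz hys hzs hy hz h₁₂ h₁₃ h₂₃ hn₁ hn₂ hn₃ ih =>
    have hsub : ∀ e', e' ∈ F → e' ∈ insert e₁ (insert e₂ (insert e₃ F)) := fun e' he' =>
      Set.mem_insert_of_mem _ (Set.mem_insert_of_mem _ (Set.mem_insert_of_mem _ he'))
    have hyF : ∀ e' ∈ {e' ∈ F | v ∉ ends e'}, y ∉ ends e' := fun e' he' => hy e' he'.1
    have hzF : ∀ e' ∈ {e' ∈ F | v ∉ ends e'}, z ∉ ends e' := fun e' he' => hz e' he'.1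
    -- membership of the three triangle edges
    have m₁ : v ∈ ends e₁ ↔ v = x ∨ v = y := by rw [h₁, Sym2.mem_iff]
    have m₂ : v ∈ ends e₂ ↔ v = x ∨ v = z := by rw [h₂, Sym2.mem_iff]
    have m₃ : v ∈ ends e₃ ↔ v = y ∨ v = z := by rw [h₃, Sym2.mem_iff]
    by_cases hvx : v = x
    · -- only `e₃ = {y, z}` survives: a pendant edge at `y` with the new vertex `z`
      subst hvx
      rw [show {e' ∈ insert e₁ (insert e₂ (insert e₃ F)) | v ∉ ends e'} =
          insert e₃ {e' ∈ F | v ∉ ends e'} from Set.ext fun e' => by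
        simp only [Set.mem_setOf_eq, Set.mem_insert_iff]
        constructor
        · rintro ⟨h' | h' | h' | h', hv⟩
          · exact (hv (h' ▸ m₁.2 (Or.inl rfl))).elim
          · exact (hv (h' ▸ m₂.2 (Or.inl rfl))).elim
          · exact Or.inl h'
          · exact Or.inr ⟨h', hv⟩
        · rintro (h' | ⟨h', hv⟩)
          · subst h'
            refine ⟨Or.inr (Or.inr (Or.inl rfl)), fun hm => ?_⟩
            rcases m₃.1 hm with h | h
            · exact hxy h
            · exact hxz h
          · exact ⟨Or.inr (Or.inr (Or.inr h')), hv⟩]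
      exact IsCactusFrom.edge ih h₃ hyz hzs hzF (fun h' => hn₃ h'.1)
    by_cases hvy : v = y
    · -- only `e₂ = {x, z}` survives
      subst hvy
      rw [show {e' ∈ insert e₁ (insert e₂ (insert e₃ F)) | v ∉ ends e'} =
          insert e₂ {e' ∈ F | v ∉ ends e'} from Set.ext fun e' => by
        simp only [Set.mem_setOf_eq, Set.mem_insert_iff]
        constructor
        · rintro ⟨h' | h' | h' | h', hv⟩
          · exact (hv (h' ▸ m₁.2 (Or.inr rfl))).elim
          · exact Or.inl h'
          · exact (hv (h' ▸ m₃.2 (Or.inl rfl))).elim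
          · exact Or.inr ⟨h', hv⟩
        · rintro (h' | ⟨h', hv⟩)
          · subst h'
            refine ⟨Or.inr (Or.inl rfl), fun hm => ?_⟩
            rcases m₂.1 hm with h | h
            · exact hvx h
            · exact hyz h
          · exact ⟨Or.inr (Or.inr (Or.inr h')), hv⟩]
      exact IsCactusFrom.edge ih h₂ hxz hzs hzF (fun h' => hn₂ h'.1)
    by_cases hvz : v = z
    · -- only `e₁ = {x, y}` survives
      subst hvz
      rw [show {e' ∈ insert e₁ (insert e₂ (insert e₃ F)) | v ∉ ends e'} =
          insert e₁ {e' ∈ F | v ∉ ends e'} from Set.ext fun e' => by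
        simp only [Set.mem_setOf_eq, Set.mem_insert_iff]
        constructor
        · rintro ⟨h' | h' | h' | h', hv⟩
          · exact Or.inl h'
          · exact (hv (h' ▸ m₂.2 (Or.inr rfl))).elim
          · exact (hv (h' ▸ m₃.2 (Or.inr rfl))).elim
          · exact Or.inr ⟨h', hv⟩
        · rintro (h' | ⟨h', hv⟩)
          · subst h'
            refine ⟨Or.inl rfl, fun hm => ?_⟩
            rcases m₁.1 hm with h | h
            · exact hvx h
            · exact hvy h
          · exact ⟨Or.inr (Or.inr (Or.inr h')), hv⟩]
      exact IsCactusFrom.edge ih h₁ hxy hys hyF (fun h' => hn₁ h'.1)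
    -- `v` is not on the triangle: all three edges survive
    have hv₁ : v ∉ ends e₁ := fun hm => by rcases m₁.1 hm with h | h; exact hvx h; exact hvy h
    have hv₂ : v ∉ ends e₂ := fun hm => by rcases m₂.1 hm with h | h; exact hvx h; exact hvz h
    have hv₃ : v ∉ ends e₃ := fun hm => by rcases m₃.1 hm with h | h; exact hvy h; exact hvz h
    rw [show {e' ∈ insert e₁ (insert e₂ (insert e₃ F)) | v ∉ ends e'} =
        insert e₁ (insert e₂ (insert e₃ {e' ∈ F | v ∉ ends e'})) from Set.ext fun e' => by
      simp only [Set.mem_setOf_eq, Set.mem_insert_iff]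
      constructor
      · rintro ⟨h' | h' | h' | h', hv⟩
        · exact Or.inl h'
        · exact Or.inr (Or.inl h')
        · exact Or.inr (Or.inr (Or.inl h'))
        · exact Or.inr (Or.inr (Or.inr ⟨h', hv⟩))
      · rintro (h' | h' | h' | ⟨h', hv⟩)
        · exact ⟨Or.inl h', h' ▸ hv₁⟩
        · exact ⟨Or.inr (Or.inl h'), h' ▸ hv₂⟩
        · exact ⟨Or.inr (Or.inr (Or.inl h')), h' ▸ hv₃⟩
        · exact ⟨Or.inr (Or.inr (Or.inr h')), hv⟩]
    exact IsCactusFrom.triangle ih h₁ h₂ h₃ hxy hxz hyz hys hzs hyF hzF h₁₂ h₁₃ h₂₃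
      (fun h' => hn₁ h'.1) (fun h' => hn₂ h'.1) (fun h' => hn₃ h'.1)

/-- The edges within `C` are the edges within `C ∪ {a}` not at `a`, for `a ∉ C`. -/
lemma within_eq_sep {ends : E → Sym2 V} {C : Set V} {a : V} (ha : a ∉ C) :
    within ends C = {e ∈ within ends (C ∪ {a}) | a ∉ ends e} := by
  ext e
  simp only [mem_within, Set.mem_setOf_eq, Set.mem_union, Set.mem_singleton_iff]
  constructor
  · rintro ⟨x, hx, y, hy, hxy⟩
    refine ⟨⟨x, Or.inl hx, y, Or.inl hy, hxy⟩, fun hm => ?_⟩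
    rw [hxy, Sym2.mem_iff] at hm
    rcases hm with h | h
    · exact ha (h ▸ hx)
    · exact ha (h ▸ hy)
  · rintro ⟨⟨x, hx, y, hy, hxy⟩, hm⟩
    refine ⟨x, ?_, y, ?_, hxy⟩
    · rcases hx with hx | hx
      · exact hx
      · exact (hm (by rw [hxy, hx]; exact Sym2.mem_mk_left _ _)).elim
    · rcases hy with hy | hy
      · exact hy
      · exact (hm (by rw [hxy, hy]; exact Sym2.mem_mk_right _ _)).elim

/-- `G[C ∪ {a}]` a triangular cactus built from the root ⟹ `G[C]` is one (`a ∉ C`). -/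
theorem isCactusFrom_within_of_insert {ends : E → Sym2 V} {s : V} {C : Set V} {a : V} (ha : a ∉ C)
    (h : IsCactusFrom ends s (within ends (C ∪ {a}))) : IsCactusFrom ends s (within ends C) := by
  rw [within_eq_sep ha]
  exact h.sep_notMem a

end Cactus

end Summit.Ventures.PercRepro2
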